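import Literature.AlgebraicGeometry.Frobenioids.DivisorMonoidTransport
import Literature.AlgebraicGeometry.Frobenioids.DivisorTransport
import Literature.AlgebraicGeometry.Frobenioids.PrimesEquivPreStep
import Literature.AlgebraicGeometry.Frobenioids.Thm49Sub
import HarnessLib

/-!
# [FrdI] Thm. 4.9, p. 89: "the right-hand and left-hand isomorphisms of Theorem 4.2 (iii)
# coincide" — from the prime-local form to ONE isomorphism of monoids `Φ₁(A) ≅ Φ₂(Ψ A)`

Mochizuki, *The geometry of Frobenioids I: the general theory*, Kyushu J. Math. **62** (2008)
293–400, §4, proof of Theorem 4.9 (Kyushu text p. 370 ll. 8–33) [cite: MochizukiFrdI2008, Thm. 4.9 p.89]: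

> "… it suffices to show that the right-hand and left-hand isomorphisms of Theorem 4.2 (iii)
> coincide … Thus, by allowing the `𝔭_i` to vary, we obtain … an isomorphism of monoids
> `Φ₁^pf(A₁)_factor ≅ Φ₂^pf(A₂)_factor` … [which] maps the subset `Φ₁(A₁)` onto the subset `Φ₂(A₂)`,
> hence determines an isomorphism of monoids `Φ₁(A₁) ≅ Φ₂(A₂)`".

PROOF-ONLY companion (seat abc-iut-w4-d099; no definitions, nothing asserted as a `Prop`). The tree's
row predicate `FrdI.T49.RightEqLeftAt F₁ F₂ Ψ A 𝔭 𝔭'` (`Thm49Sub.lean`) is PRIME-LOCAL: one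
isomorphism of monoids `𝔭.submonoid ≃* 𝔭'.submonoid` computing both `Div(Ψ φ)` on the co-angular
pre-steps `φ` out of `A` (right-hand) and `(Ψψ)_*Div(Ψψ)` on the co-angular pre-steps `ψ` into `A`
(left-hand). Here we GLUE: if every prime `𝔭` of `Φ₁(A)` has a partner `𝔭'` with `RightEqLeftAt` at
`(A, 𝔭, 𝔭')`, then there is ONE isomorphism of monoids `M : Φ₁(A) ≃* Φ₂(Ψ A)` with
`M(Div φ) = Div(Ψ φ)` for EVERY pre-step `φ` out of `A` and `(Ψψ)^* M(y) = Div(Ψψ)` whenever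
`ψ^* y = Div ψ` for EVERY pre-step `ψ` into `A` (`PreFrobenioid.exists_mulEquiv_right_left`,
`FrdI.T49.exists_mulEquiv_of_rightEqLeftAt`) — the GLOBAL form of "right = left at `A`" (the shape
row T49-L05 transfers along pull-back morphisms, cf. seat abc-iut-w4-d105's note of 2026-08-26).

Ingredients: the right-hand transport glued to a monoid isomorphism (`exists_mulEquiv_div_map`,
`DivisorMonoidTransport.lean`); the LEFT-HAND transport `x_ψ ↦ x_{Ψψ}` as a bijection of `Φ₁(A)` onto
`Φ₂(Ψ A)` respecting divisibility (`exists_invDivTransport`, from the order transport of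
`DivisorTransport.lean`, seat abc-iut-L1-t14); and the monoid-level fact that two
divisibility-isomorphisms of perfect perf-factorial monoids which agree on primary elements agree
(`eq_of_dvd_iff_of_forall_isPrimary`: an element is determined by its primary divisors,
`IsPerfFactorial.dvd_of_forall_isPrimary_dvd'`); `x_ψ` bookkeeping from `BiratUnitsDiv.lean` /
`CoprimarySteps.lean` / `PrimesEquivPreStep.lean`. Nothing here bears on [IUTchIII].
-/

namespace Literature.AlgebraicGeometry.Frobenioids

open CategoryTheory Opposite

section Monoid

universe uM uN

variable {M : Type uM} [CommMonoid M] {N : Type uN} [CommMonoid N]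

/-- **Two divisibility-isomorphisms of perfect perf-factorial monoids which agree on primary elements
agree**: an element is the least common multiple of its primary divisors (Def. 2.4 (i)(c)(d)).
[cite: MochizukiFrdI2008, Def. 2.4 (i) p.47] -/
theorem eq_of_dvd_iff_of_forall_isPrimary (hM : IsPerfFactorial M) (hN : IsPerfFactorial N)
    (hMp : IsPerfect M) (hNp : IsPerfect N) (f g : M → N) (hf : Function.Bijective f)
    (hg : Function.Bijective g) (hfd : ∀ x y : M, x ∣ y ↔ f x ∣ f y)
    (hgd : ∀ x y : M, x ∣ y ↔ g x ∣ g y) (hfg : ∀ p : M, IsPrimary p → f p = g p) (x : M) :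
    f x = g x := by
  have key : ∀ f g : M → N, Function.Bijective f → (∀ x y : M, x ∣ y ↔ f x ∣ f y) →
      (∀ x y : M, x ∣ y ↔ g x ∣ g y) → (∀ p : M, IsPrimary p → f p = g p) → f x ∣ g x := by
    intro f g hf hfd hgd hfg
    refine hN.dvd_of_forall_isPrimary_dvd' hNp fun q hq hqx => ?_
    obtain ⟨p, rfl⟩ := hf.2 q
    have hp : IsPrimary p := (isPrimary_map_iff_of_dvd_iff hM hN hMp hNp f hf hfd p).mp hq
    rw [hfg p hp]
    exact (hgd p x).mp ((hfd p x).mpr hqx)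
  haveI : IsCancelMul N := isIntegral_iff_isCancelMul.mp hN.isDivisorial.isPreDivisorial.isIntegral
  exact dvd_antisymm_of_isSharp hN.isDivisorial.isSharp (key f g hf hfd hgd hfg)
    (key g f hg hgd hfd fun p hp => (hfg p hp).symm)

end Monoid

namespace PreFrobenioid

universe w v v' u u'

variable {D₁ : Type u} [Category.{v} D₁] {Φ₁ : D₁ᵒᵖ ⥤ CommMonCat.{w}} {C₁ : Type u'} [Category.{v'} C₁]
  {D₂ : Type u} [Category.{v} D₂] {Φ₂ : D₂ᵒᵖ ⥤ CommMonCat.{w}} {C₂ : Type u'} [Category.{v'} C₂]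
  {F₁ : C₁ ⥤ ElemFrobenioid Φ₁} {F₂ : C₂ ⥤ ElemFrobenioid Φ₂}

/-- **The left-hand transport `L_A : Φ₁(A) → Φ₂(Ψ A)`, `x_ψ ↦ x_{Ψψ}`** (Def. 1.3 (iii)(d), second
equivalence; Thm. 4.2 (iii), left-hand side): for Frobenioids of isotropic type and an equivalence `Ψ`
with `Ψ`, `Ψ⁻¹` preserving pre-steps there is a bijection `L : Φ₁(A) → Φ₂(Ψ A)` with
`x ≤ y ↔ L x ≤ L y` and `L(x_ψ) = x_{Ψψ}` for every pre-step `ψ` into `A`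
(`x_ψ = (ψ^*)⁻¹ Div ψ`). [cite: MochizukiFrdI2008, Thm. 4.9 p.89] -/
theorem exists_invDivTransport (Ψ : C₁ ≌ C₂) (hF₁ : IsFrobenioid F₁) (hF₂ : IsFrobenioid F₂)
    (histr₁ : IsOfIsotropicType F₁) (histr₂ : IsOfIsotropicType F₂)
    (hpre : ∀ ⦃X Y : C₁⦄ (φ : X ⟶ Y), IsPreStep F₁ φ → IsPreStep F₂ (Ψ.functor.map φ))
    (hpre' : ∀ ⦃X Y : C₂⦄ (φ : X ⟶ Y), IsPreStep F₂ φ → IsPreStep F₁ (Ψ.inverse.map φ)) (A : C₁) :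
    ∃ L : Φ₁.obj (op (baseObj F₁ A)) → Φ₂.obj (op (baseObj F₂ (Ψ.functor.obj A))),
      Function.Bijective L ∧ (∀ x y, x ∣ y ↔ L x ∣ L y) ∧
        ∀ ⦃B : C₁⦄ (ψ : B ⟶ A) (hψ : IsPreStep F₁ ψ),
          L (invDiv F₁ ψ hψ.2) = invDiv F₂ (Ψ.functor.map ψ) (hpre ψ hψ).2 := by
  haveI : IsCancelMul (Φ₁.obj (op (baseObj F₁ A))) := isIntegral_iff_isCancelMul.mp
    (hF₁.isPreFrobenioid.isDivisorial _).isPreDivisorial.isIntegral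
  -- a co-angular pre-step `ψo x : Bo x → A` with `x_{ψo x} = x`, for every `x ∈ Φ₁(A)`
  choose Bo ψo hψo hψox using fun x : Φ₁.obj (op (baseObj F₁ A)) => hF₁.iii_d_over_surj A x
  have hL : ∀ ⦃B : C₁⦄ (ψ : B ⟶ A) (hψ : IsPreStep F₁ ψ),
      invDiv F₂ (Ψ.functor.map (ψo (invDiv F₁ ψ hψ.2))) (hpre _ (hψo _).2).2 =
        invDiv F₂ (Ψ.functor.map ψ) (hpre ψ hψ).2 :=
    fun B ψ hψ => (invDiv_eq_iff_map Ψ hF₁ hF₂ histr₁ histr₂ hpre hpre' hψ (hψo _).2).mp (hψox _)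
  have hdvd : ∀ x y, x ∣ y ↔ invDiv F₂ (Ψ.functor.map (ψo x)) (hpre _ (hψo x).2).2 ∣
      invDiv F₂ (Ψ.functor.map (ψo y)) (hpre _ (hψo y).2).2 := by
    intro x y
    have h := invDiv_dvd_iff_map Ψ hF₁ hF₂ histr₁ histr₂ hpre hpre' (hψo y).2 (hψo x).2
    rw [hψox, hψox] at h
    exact h
  refine ⟨fun x => invDiv F₂ (Ψ.functor.map (ψo x)) (hpre _ (hψo x).2).2,
    ⟨fun x y hxy => ?_, fun y => ?_⟩, hdvd, hL⟩
  · -- injective: mutual divisibility in the sharp monoid `Φ₁(A)`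
    have hxy' : invDiv F₂ (Ψ.functor.map (ψo x)) (hpre _ (hψo x).2).2 =
        invDiv F₂ (Ψ.functor.map (ψo y)) (hpre _ (hψo y).2).2 := hxy
    exact dvd_antisymm_of_isSharp (hF₁.isPreFrobenioid.isDivisorial _).isSharp
      ((hdvd x y).mpr (hxy' ▸ dvd_rfl)) ((hdvd y x).mpr (hxy' ▸ dvd_rfl))
  · -- surjective: pull a pre-step into `Ψ A` with `x_ψ = y` back along the fully faithful `Ψ`
    obtain ⟨B', ψ, hψ, hψy⟩ := hF₂.iii_d_over_surj (Ψ.functor.obj A) y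
    let e : Ψ.functor.obj (Ψ.functor.objPreimage B') ≅ B' := Ψ.functor.objObjPreimageIso B'
    let χ : Ψ.functor.objPreimage B' ⟶ A := Ψ.functor.preimage (e.hom ≫ ψ)
    have hχm : Ψ.functor.map χ = e.hom ≫ ψ := Ψ.functor.map_preimage _
    have heψ : IsPreStep F₂ (e.hom ≫ ψ) := IsPreStep.comp F₂ (isPreStep_of_isIso F₂ _) hψ.2
    have hχ : IsPreStep F₁ χ := isPreStep_of_map_of_inverse Ψ hF₁ hpre' χ (by rw [hχm]; exact heψ)
    refine ⟨invDiv F₁ χ hχ.2, ?_⟩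
    show invDiv F₂ (Ψ.functor.map (ψo (invDiv F₁ χ hχ.2))) _ = y
    rw [hL χ hχ, RatFrac.invDiv_congr F₂ hχm (hpre χ hχ).2 heψ.2,
      invDiv_comp_eq_mul e.hom ψ (isBaseIso_of_isIso F₂ e.hom) hψ.2 heψ.2,
      invDiv_eq_one_of_isIso hF₂.isPreFrobenioid e.hom (isBaseIso_of_isIso F₂ e.hom), map_one, mul_one,
      hψy]

/-- **"Right = left" at `A`, glued over the primes** (p. 89 ll. 8–33): for Frobenioids of perfect and
isotropic type with perf-factorial divisor monoids and `Ψ`, `Ψ⁻¹` preserving pre-steps, if every prime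
`𝔭` of `Φ₁(A)` carries an isomorphism of monoids `𝔭.submonoid ≃* 𝔭'.submonoid` onto some prime ray of
`Φ₂(Ψ A)` computing BOTH `Div(Ψ φ)` on the co-angular pre-steps `φ` out of `A` with `Div φ ∈ 𝔭` and
`(Ψψ)_*Div(Ψψ)` on the co-angular pre-steps `ψ` into `A` with `ψ_*Div ψ ∈ 𝔭` (the coincidence of the
right-hand and left-hand isomorphisms of Thm. 4.2 (iii) at `(A, 𝔭)`), then ONE isomorphism of monoids
`M : Φ₁(A) ≃* Φ₂(Ψ A)` computes `Div(Ψ φ) = M(Div φ)` for every pre-step `φ` out of `A` and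
`(Ψψ)^*(M y) = Div(Ψψ)` whenever `ψ^* y = Div ψ`, for every pre-step `ψ` into `A`.
[cite: MochizukiFrdI2008, Thm. 4.9 p.89] -/
theorem exists_mulEquiv_right_left (Ψ : C₁ ≌ C₂) (hF₁ : IsFrobenioid F₁) (hF₂ : IsFrobenioid F₂)
    (hperf₁ : IsOfPerfectType F₁) (hperf₂ : IsOfPerfectType F₂)
    (histr₁ : IsOfIsotropicType F₁) (histr₂ : IsOfIsotropicType F₂)
    (hpf₁ : Objectwise (fun M _ => IsPerfFactorial M) Φ₁)
    (hpf₂ : Objectwise (fun M _ => IsPerfFactorial M) Φ₂)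
    (hpre : ∀ ⦃X Y : C₁⦄ (φ : X ⟶ Y), IsPreStep F₁ φ → IsPreStep F₂ (Ψ.functor.map φ))
    (hpre' : ∀ ⦃X Y : C₂⦄ (φ : X ⟶ Y), IsPreStep F₂ φ → IsPreStep F₁ (Ψ.inverse.map φ)) (A : C₁)
    (h : ∀ 𝔭 : Primes (Φ₁.obj (op (baseObj F₁ A))),
      ∃ (𝔭' : Primes (Φ₂.obj (op (baseObj F₂ (Ψ.functor.obj A)))))
        (m : 𝔭.submonoid ≃* 𝔭'.submonoid),
        (∀ ⦃B : C₁⦄ (φ : A ⟶ B), IsCoAngularPreStep F₁ φ → ∀ hφ : Div F₁ φ ∈ 𝔭.submonoid,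
            (m ⟨Div F₁ φ, hφ⟩ : Φ₂.obj (op (baseObj F₂ (Ψ.functor.obj A)))) =
              Div F₂ (Ψ.functor.map φ)) ∧
        ∀ ⦃B : C₁⦄ (ψ : B ⟶ A), IsCoAngularPreStep F₁ ψ →
          ∀ (y : Φ₁.obj (op (baseObj F₁ A))) (hy : y ∈ 𝔭.submonoid),
            pull Φ₁ (Base F₁ ψ) y = Div F₁ ψ →
              pull Φ₂ (Base F₂ (Ψ.functor.map ψ))
                  (m ⟨y, hy⟩ : Φ₂.obj (op (baseObj F₂ (Ψ.functor.obj A)))) =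
                Div F₂ (Ψ.functor.map ψ)) :
    ∃ M : Φ₁.obj (op (baseObj F₁ A)) ≃* Φ₂.obj (op (baseObj F₂ (Ψ.functor.obj A))),
      (∀ ⦃B : C₁⦄ (φ : A ⟶ B), IsPreStep F₁ φ → M (Div F₁ φ) = Div F₂ (Ψ.functor.map φ)) ∧
      ∀ ⦃B : C₁⦄ (ψ : B ⟶ A), IsPreStep F₁ ψ → ∀ y : Φ₁.obj (op (baseObj F₁ A)),
        pull Φ₁ (Base F₁ ψ) y = Div F₁ ψ →
          pull Φ₂ (Base F₂ (Ψ.functor.map ψ)) (M y) = Div F₂ (Ψ.functor.map ψ) := by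
  -- the right-hand transport, glued to a monoid isomorphism by the ray isomorphisms
  obtain ⟨M, hM⟩ := exists_mulEquiv_div_map Ψ hF₁ hF₂ hperf₁ hperf₂ histr₁ histr₂ hpf₁ hpf₂ hpre
    hpre' A fun 𝔭 => by
      obtain ⟨𝔭', m, hr, -⟩ := h 𝔭
      exact ⟨𝔭', m, hr⟩
  -- the left-hand transport
  obtain ⟨L, hLb, hLd, hL⟩ := exists_invDivTransport Ψ hF₁ hF₂ histr₁ histr₂ hpre hpre' A
  have hMon : IsPerfFactorial (Φ₁.obj (op (baseObj F₁ A))) := hpf₁ _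
  have hNon : IsPerfFactorial (Φ₂.obj (op (baseObj F₂ (Ψ.functor.obj A)))) := hpf₂ _
  have hMp := isPerfect_divisorMonoid hF₁ hperf₁ A
  have hNp := isPerfect_divisorMonoid hF₂ hperf₂ (Ψ.functor.obj A)
  have hMd : ∀ x y : Φ₁.obj (op (baseObj F₁ A)), x ∣ y ↔ M x ∣ M y := fun x y =>
    ⟨fun hxy => map_dvd M hxy, fun hxy => by simpa using map_dvd M.symm hxy⟩
  -- `M = L` on primary elements: at the prime `𝔭 ∋ p`, both are computed by the ray isomorphism `m`
  have hprim : ∀ p : Φ₁.obj (op (baseObj F₁ A)), IsPrimary p → M p = L p := by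
    intro p hp
    -- `p = Div φ` (right) and `p = x_ψ` (left) for co-angular pre-steps `φ : A → B`, `ψ : B' → A`
    obtain ⟨B, φ, hφ, hφp⟩ := hF₁.iii_d_under_surj A p
    obtain ⟨B', ψ, hψ, hψp⟩ := hF₁.iii_d_over_surj A p
    let 𝔭 : Primes (Φ₁.obj (op (baseObj F₁ A))) :=
      Quotient.mk (primarySetoid (Φ₁.obj (op (baseObj F₁ A)))) ⟨p, hp⟩
    have hp𝔭 : p ∈ 𝔭.submonoid := (Primes.mem_submonoid_iff' 𝔭 p).mpr (Or.inr ⟨hp, rfl⟩)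
    obtain ⟨𝔭', m, hr, hl⟩ := h 𝔭
    haveI : IsIso (Base F₂ (Ψ.functor.map ψ)) := (hpre ψ hψ.2).2
    -- right: `M p = m p`
    have h1 : M p = (m ⟨p, hp𝔭⟩ : Φ₂.obj (op (baseObj F₂ (Ψ.functor.obj A)))) := by
      have hφp' : Div F₁ φ ∈ 𝔭.submonoid := hφp.symm ▸ hp𝔭
      have e1 : M p = M (Div F₁ φ) := by rw [hφp]
      have e2 : (⟨p, hp𝔭⟩ : 𝔭.submonoid) = ⟨Div F₁ φ, hφp'⟩ := Subtype.ext hφp.symm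
      rw [e1, hM φ hφ.2, e2, hr φ hφ hφp']
    -- left: `m p = x_{Ψψ} = L p`
    have h2 : (m ⟨p, hp𝔭⟩ : Φ₂.obj (op (baseObj F₂ (Ψ.functor.obj A)))) = L p := by
      have hpull : pull Φ₁ (Base F₁ ψ) p = Div F₁ ψ := by rw [← hψp, pull_invDiv]
      have h3 := hl ψ hψ p hp𝔭 hpull
      apply pull_injective_of_isIso Φ₂ (Base F₂ (Ψ.functor.map ψ))
      rw [h3, ← hψp, hL ψ hψ.2, pull_invDiv]
    exact h1.trans h2
  have hML : ∀ x, M x = L x := eq_of_dvd_iff_of_forall_isPrimary hMon hNon hMp hNp M L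
    M.bijective hLb hMd hLd hprim
  refine ⟨M, hM, fun B ψ hψ y hy => ?_⟩
  haveI : IsIso (Base F₁ ψ) := hψ.2
  have hy' : y = invDiv F₁ ψ hψ.2 :=
    pull_injective_of_isIso Φ₁ (Base F₁ ψ) (by rw [hy, pull_invDiv])
  rw [hy', hML, hL ψ hψ, pull_invDiv]

end PreFrobenioid

namespace FrdI.T49

universe w v v' u u'

variable {D₁ : Type u} [Category.{v} D₁] {Φ₁ : D₁ᵒᵖ ⥤ CommMonCat.{w}} {C₁ : Type u'} [Category.{v'} C₁]
  {D₂ : Type u} [Category.{v} D₂] {Φ₂ : D₂ᵒᵖ ⥤ CommMonCat.{w}} {C₂ : Type u'} [Category.{v'} C₂]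
  {F₁ : C₁ ⥤ ElemFrobenioid Φ₁} {F₂ : C₂ ⥤ ElemFrobenioid Φ₂} {Ψ : C₁ ≌ C₂}

/-- **Global form of `RightEqLeftAt`** (p. 89 ll. 8–33): in a `T42.Setting`, if every prime `𝔭` of
`Φ₁(A)` has a partner `𝔭'` with `RightEqLeftAt F₁ F₂ Ψ A 𝔭 𝔭'`, then ONE isomorphism of monoids
`M : Φ₁(A) ≃* Φ₂(Ψ A)` has the right-hand property on all pre-steps out of `A` and the left-hand
property on all pre-steps into `A`. [cite: MochizukiFrdI2008, Thm. 4.9 p.89] -/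
theorem exists_mulEquiv_of_rightEqLeftAt (S : T42.Setting F₁ F₂ Ψ) {A : C₁}
    (h : ∀ 𝔭 : Primes (Φ₁.obj (op (PreFrobenioid.baseObj F₁ A))),
      ∃ 𝔭' : Primes (Φ₂.obj (op (PreFrobenioid.baseObj F₂ (Ψ.functor.obj A)))),
        RightEqLeftAt F₁ F₂ Ψ A 𝔭 𝔭') :
    ∃ M : Φ₁.obj (op (PreFrobenioid.baseObj F₁ A)) ≃*
        Φ₂.obj (op (PreFrobenioid.baseObj F₂ (Ψ.functor.obj A))),
      (∀ ⦃B : C₁⦄ (φ : A ⟶ B), PreFrobenioid.IsPreStep F₁ φ →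
          M (PreFrobenioid.Div F₁ φ) = PreFrobenioid.Div F₂ (Ψ.functor.map φ)) ∧
      ∀ ⦃B : C₁⦄ (ψ : B ⟶ A), PreFrobenioid.IsPreStep F₁ ψ →
        ∀ y : Φ₁.obj (op (PreFrobenioid.baseObj F₁ A)),
          pull Φ₁ (PreFrobenioid.Base F₁ ψ) y = PreFrobenioid.Div F₁ ψ →
            pull Φ₂ (PreFrobenioid.Base F₂ (Ψ.functor.map ψ)) (M y) =
              PreFrobenioid.Div F₂ (Ψ.functor.map ψ) := by
  refine PreFrobenioid.exists_mulEquiv_right_left Ψ S.isFrobenioid₁ S.isFrobenioid₂ S.perfect₁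
    S.perfect₂ S.isotropic₁ S.isotropic₂ S.perfFactorial₁ S.perfFactorial₂ S.preStep_map
    S.preStep_inv A fun 𝔭 => ?_
  obtain ⟨𝔭', m, hr, hl⟩ := h 𝔭
  exact ⟨𝔭', m, hr, hl⟩

/-- The same, consuming the family `e = Ψ^Prime` of `FrdI.T49.SufficesRightEqLeft`'s hypothesis at a
universally Div-Frobenius-trivial object. [cite: MochizukiFrdI2008, Thm. 4.9 p.89] -/
theorem exists_mulEquiv_of_rightEqLeftAt_family (S : T42.Setting F₁ F₂ Ψ)
    (e : ∀ A : C₁, Primes (Φ₁.obj (op (PreFrobenioid.baseObj F₁ A))) ≃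
      Primes (Φ₂.obj (op (PreFrobenioid.baseObj F₂ (Ψ.functor.obj A)))))
    (hRL : ∀ (A : C₁), PreFrobenioid.IsUniversallyDivFrobeniusTrivial F₁ A →
      ∀ 𝔭 : Primes (Φ₁.obj (op (PreFrobenioid.baseObj F₁ A))), RightEqLeftAt F₁ F₂ Ψ A 𝔭 (e A 𝔭))
    {A : C₁} (hA : PreFrobenioid.IsUniversallyDivFrobeniusTrivial F₁ A) :
    ∃ M : Φ₁.obj (op (PreFrobenioid.baseObj F₁ A)) ≃*
        Φ₂.obj (op (PreFrobenioid.baseObj F₂ (Ψ.functor.obj A))),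
      (∀ ⦃B : C₁⦄ (φ : A ⟶ B), PreFrobenioid.IsPreStep F₁ φ →
          M (PreFrobenioid.Div F₁ φ) = PreFrobenioid.Div F₂ (Ψ.functor.map φ)) ∧
      ∀ ⦃B : C₁⦄ (ψ : B ⟶ A), PreFrobenioid.IsPreStep F₁ ψ →
        ∀ y : Φ₁.obj (op (PreFrobenioid.baseObj F₁ A)),
          pull Φ₁ (PreFrobenioid.Base F₁ ψ) y = PreFrobenioid.Div F₁ ψ →
            pull Φ₂ (PreFrobenioid.Base F₂ (Ψ.functor.map ψ)) (M y) =
              PreFrobenioid.Div F₂ (Ψ.functor.map ψ) :=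
  exists_mulEquiv_of_rightEqLeftAt S fun 𝔭 => ⟨e A 𝔭, hRL A hA 𝔭⟩

end FrdI.T49

end Literature.AlgebraicGeometry.Frobenioids
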